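import Summits.BirchSwinnertonDyer.BirchSwinnertonDyer.Theorems.ByReductionTypeAtTwoAdditivePotGoodLowerHalfT0NarrowRankLayerBoundsDoor
import Summits.BirchSwinnertonDyer.BirchSwinnertonDyer.Theorems.ByReductionTypeAtTwoAdditivePotGoodLowerHalfT0NarrowRankRungRowsB
import Literature.NumberTheory.NumberFields.CubicFieldUnitSignatureCertificate
import HarnessLib

/-!
# K4 crux `AdditiveRankZeroAtTwo` (19098), children C3″ `AdditivePotGoodLowerHalfAtTwo` (22617) / C1″ (22615): the RUNG `m = 2` STAMP of the census row `293200be1`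
# (`Δ_cubic > 0`, totally real cubic point field of discriminant `733`, two primes above `2`; letters JUMP01, JUMP12, EQUAL23) READ THROUGH THE
# EDGAR–MOLLIN–PETERSON DOOR: (A)₂ and the BSD₂ rungs from the FOUR elementary data of eng-2's CERT-NARROW6-E2 v1.3 on the concrete layers
# `A₂ = ℚ(θ) ⊔ ℚ_2` (degree `12`) and `A₃ = ℚ(θ) ⊔ ℚ_3` (degree `24`) — `h(A₂)` odd, `h(A₃)` odd, `2^2 ≤ #(U⁺/U²)(A₂)`, `2^22 ≤ #sign(U_{A₃})`
# (seat `bsd-2adic-k4-w2` GEN 15; `--supports stmt-BirchSwinnertonDyer-22617 --as helper`)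

Cell `bsd-2adic`.  GEN 12's `conjA_two_293200be1_of_narrowRankEq_succ hθ 2 _ hnr` displayed ONE opaque equality of narrow `2`-ranks at the abstract layers `2 / 3`
(valued EQUAL23 by PARI `bnfnarrow`, GRH, eng-2 v1.2).  eng-2 GEN 16's v1.3 (`CERT-NARROW6-E2.md` §6.1, kit j338181) valued the letter GRH-FREE through this
seat's GEN 13 door `index_range_pow_two_narrowClassGroup_eq_of_bounds` (p750350) from four elementary data: (hK) `h(A₂) = 1` (quotient certificate,
`bnfcertify` flag 4); (hL) `h(A₃)` odd (genus theory: a unit of `A₂` with dyadic Hilbert symbol `(u, 2+η₂)_P = −1` at both primes above `2`, `rank_H = t − 1 = 1`);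
(hlow) `2^2 ≤ #(U⁺/U²)(A₂)` (`2^2 − 1` totally positive unit classes of `A₂` witnessed non-square at one split prime); (hsig) `2^22 ≤ #sign(U_{A₃})`
(exact signs of `23` actual units of the degree-`24` field).  This file is the KERNEL FRAME of that reading: GEN 15's generic door
`AddKatoTwo.conjA_two_cubicModel_of_narrowRank_layer_bounds` (rung `m = 2` with the concrete models `A_j = ℚ(θ) ⊔ (CyclotomicZp.zpExtension 2).layer j ⊂ ℚ̄`,
`a + b = 2 + 22 = 24` discharged) in the row's census currency: §1 `isTotallyReal_adjoin_disc733_lb` (three located real roots), ★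
`AddKatoTwo.conjA_two_293200be1_of_layerBounds₂₃ hθ hK hL hlow hsig` — (A)₂ with the FOUR data DISPLAYED as hypotheses on the concrete fields (each a finite,
GRH-free, elementary statement; each separately dischargeable in the kernel: hK/hL by genus theory with dyadic non-norm units, hlow by `2` totally positive
units, hsig by `22` unit signatures); §2 GEN 3's rungs re-keyed `AddPotGoodInstances.bsdp_two_293200be1_layerBounds₂₃`, `bsdp_two_of_isIsogenous_293200be1_layerBounds₂₃`.

HONEST FRAMING (D-0036 / D-0054 / D-0152): conditional theorems; the four data are INSTRUMENT-tier (valued GRH-free by eng-2 v1.3, not kernel); `hSharp` is the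
Kato-at-`2` SHARP reading (D-audit PASS).  Census tier of the row: CERT (unchanged count; the displayed datum is now elementary and split in four).  Closes nothing
at the `∀`-level (C3″ 22617 / C1″ 22615 OPEN); nothing booked (D-0054); no rung moves; BSD is not proved by any of this.  THEOREMS ONLY (no `def`).

References: [EdgarMollinPeterson1986] Thm. 2.1; [FrohlichTaylor1990] Ch. V §1; [Fukuda1994] Thm. 1 (2), p. 264; [Washington1997] §13.1 Prop. 13.2, Lemma 13.3;
[CoatesSujatha2005] (A), Thm. 3.4; [Kato2004Asterisque] Thm. 12.5 (1)(3), 13.8, 14.14; [Cassels1965ArithmeticVIII] Thm. 1.3; [Miller2011LMS] Def. 1.1;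
[Cohen1993] §4.1.3, App. B.
-/

set_option autoImplicit false
-- the Theorems namespace of this sub repeats the summit name by design (D-0017 nested layout)
set_option linter.dupNamespace false

noncomputable section

open scoped Classical IntermediateField NumberField Real nonZeroDivisors

/-! ## §1 The census instance at the rung `m = 2` (namespace `AddKatoTwo`) -/

namespace Summit.BirchSwinnertonDyer.BirchSwinnertonDyer.Theorems.AddKatoTwo

open WeierstrassCurve Field Polynomial IsDedekindDomain NumberField Matrix Literature.NumberTheory.EllipticCurves
  Literature.NumberTheory.GaloisRepresentations
  Literature.NumberTheory.IwasawaTheory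
  Literature.NumberTheory.NumberFields
  Literature.Geometry.Kaehler.ComplexTorus
  Summit.BirchSwinnertonDyer.BirchSwinnertonDyer.Theorems.SteinbergFibreAtTwo
  Summit.BirchSwinnertonDyer.BirchSwinnertonDyer.Theorems.AlignedTransportAtTwoTorsionPointField
  Summit.BirchSwinnertonDyer.BirchSwinnertonDyer.Theses.ByReductionTypeAtTwo

/-- **A monic integer cubic with a root `β` of degree `3` is irreducible** (restated to keep this file's imports minimal). [folklore] -/
private theorem irreducibleCubic_of_finrank_three_lb293200be1 {p q r : ℤ} {β : AlgebraicClosure ℚ}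
    (hβ : aeval β (Cubic.toPoly ⟨1, (p : ℚ), q, r⟩) = 0) (h3 : Module.finrank ℚ (IntermediateField.adjoin ℚ {β}) = 3) :
    Irreducible (Cubic.toPoly ⟨1, (p : ℚ), q, r⟩) := by
  have hfm : (Cubic.toPoly ⟨1, (p : ℚ), q, r⟩).Monic := Cubic.monic_of_a_eq_one'
  have hβint : IsIntegral ℚ β := ⟨_, hfm, by rwa [← aeval_def]⟩
  have hdeg : (minpoly ℚ β).natDegree = (Cubic.toPoly ⟨1, (p : ℚ), q, r⟩).natDegree := by
    rw [← IntermediateField.adjoin.finrank hβint, h3, Cubic.natDegree_of_a_ne_zero' one_ne_zero]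
  have heq : Cubic.toPoly ⟨1, (p : ℚ), q, r⟩ = minpoly ℚ β :=
    Polynomial.eq_of_monic_of_dvd_of_natDegree_le (minpoly.monic hβint) hfm (minpoly.dvd ℚ β hβ) hdeg.ge
  rw [heq]
  exact minpoly.irreducible hβint

section Embeddings

variable {θ : AlgebraicClosure ℚ}

/-- The cubic relation as a real equation gives a root of `Cubic.toPoly` over `ℝ`. [folklore] -/
private theorem aeval_real_of_eq_lb293200be1 {x : ℝ} (hx : x ^ 3 + (-1) * x ^ 2 + (-7) * x + (8) = 0) :
    aeval x (Cubic.toPoly ⟨1, ((-1 : ℤ) : ℚ), ((-7 : ℤ) : ℚ), ((8 : ℤ) : ℚ)⟩) = 0 := by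
  simp only [Cubic.toPoly, map_one, one_mul, aeval_add, aeval_mul, aeval_C, aeval_X_pow, aeval_X, eq_ratCast,
    Rat.cast_intCast]
  push_cast
  linear_combination hx

/-- **`ℚ(θ)` is TOTALLY REAL** for `θ³ + (-1)θ² + (-7)θ + (8) = 0` (discriminant `733 > 0`): three real roots located in the rational intervals
`(-2.7, -2.69)`, `(1.17, 1.18)`, `(2.51, 2.52)` (sign changes; IVT + lifting `exists_ringHom_adjoin_apply_gen_eq`), hence three distinct real embeddings of the cubic field.
[cite: Cohen1993, §4.1.3 and App. B (totally real cubic fields)] -/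
theorem isTotallyReal_adjoin_disc733_lb (hθ : aeval θ (Cubic.toPoly ⟨1, ((-1 : ℤ) : ℚ), ((-7 : ℤ) : ℚ), ((8 : ℤ) : ℚ)⟩) = 0) :
    haveI : FiniteDimensional ℚ ↥ℚ⟮θ⟯ :=
      IntermediateField.adjoin.finiteDimensional ⟨_, Cubic.monic_of_a_eq_one', by rwa [← aeval_def]⟩
    haveI : NumberField ↥ℚ⟮θ⟯ := NumberField.mk
    IsTotallyReal ↥ℚ⟮θ⟯ := by
  haveI : FiniteDimensional ℚ ↥ℚ⟮θ⟯ :=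
      IntermediateField.adjoin.finiteDimensional ⟨_, Cubic.monic_of_a_eq_one', by rwa [← aeval_def]⟩
  haveI : NumberField ↥ℚ⟮θ⟯ := NumberField.mk
  have h3 : Module.finrank ℚ ↥ℚ⟮θ⟯ = 3 := finrank_adjoin_eq_three_of_irreducible irreducible_cubic_disc_733 hθ
  obtain ⟨x0, hl0, hu0, hx0⟩ := exists_cubic_root_Ioo_of_neg_of_pos (p := (-1 : ℝ)) (q := (-7)) (r := (8))
    (l := (-27 / 10)) (u := (-269 / 100)) (by norm_num) (by norm_num) (by norm_num)
  obtain ⟨x1, hl1, hu1, hx1⟩ := exists_cubic_root_Ioo_of_pos_of_neg (p := (-1 : ℝ)) (q := (-7)) (r := (8))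
    (l := (117 / 100)) (u := (59 / 50)) (by norm_num) (by norm_num) (by norm_num)
  obtain ⟨x2, hl2, hu2, hx2⟩ := exists_cubic_root_Ioo_of_neg_of_pos (p := (-1 : ℝ)) (q := (-7)) (r := (8))
    (l := (251 / 100)) (u := (63 / 25)) (by norm_num) (by norm_num) (by norm_num)
  obtain ⟨ρ₀, hρ₀⟩ := exists_ringHom_adjoin_apply_gen_eq (P := ⟨1, ((-1 : ℤ) : ℚ), ((-7 : ℤ) : ℚ), ((8 : ℤ) : ℚ)⟩) rfl
    irreducible_cubic_disc_733 hθ (aeval_real_of_eq_lb293200be1 hx0)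
  obtain ⟨ρ₁, hρ₁⟩ := exists_ringHom_adjoin_apply_gen_eq (P := ⟨1, ((-1 : ℤ) : ℚ), ((-7 : ℤ) : ℚ), ((8 : ℤ) : ℚ)⟩) rfl
    irreducible_cubic_disc_733 hθ (aeval_real_of_eq_lb293200be1 hx1)
  obtain ⟨ρ₂, hρ₂⟩ := exists_ringHom_adjoin_apply_gen_eq (P := ⟨1, ((-1 : ℤ) : ℚ), ((-7 : ℤ) : ℚ), ((8 : ℤ) : ℚ)⟩) rfl
    irreducible_cubic_disc_733 hθ (aeval_real_of_eq_lb293200be1 hx2)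
  have hne : ∀ {φ ψ : ↥ℚ⟮θ⟯ →+* ℝ} {a c : ℝ}, φ (IntermediateField.AdjoinSimple.gen ℚ θ) = a → ψ (IntermediateField.AdjoinSimple.gen ℚ θ) = c → a ≠ c → φ ≠ ψ := by
    intro φ ψ a c ha hc hac h; rw [h] at ha; exact hac (ha.symm.trans hc)
  have h01 : ρ₀ ≠ ρ₁ := hne hρ₀ hρ₁ (by intro h; linarith)
  have h02 : ρ₀ ≠ ρ₂ := hne hρ₀ hρ₂ (by intro h; linarith)
  have h12 : ρ₁ ≠ ρ₂ := hne hρ₁ hρ₂ (by intro h; linarith)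
  refine isTotallyReal_of_three_realEmbeddings h3 ![ρ₀, ρ₁, ρ₂] ?_
  intro a c hac
  fin_cases a <;> fin_cases c <;> simp_all

end Embeddings

set_option maxHeartbeats 1600000 in
/-- **(A) at `2` for `293200be1` from the FOUR Edgar–Mollin–Peterson data at the layer pair `(2, 3)`** — NO index, NO bound, NO narrow-rank equality displayed:
the generic door `conjA_two_cubicModel_of_narrowRank_layer_bounds` at `m = 2`, `a = 2`, `b = 22` (`2 + 22 = 24 = [A₃ : ℚ]`), for the totally real cubic point
field `ℚ(θ) = ℚ(x(P))`, `θ³ + (-1)θ² + (-7)θ + (8) = 0` (`d = 733`; exact change of generator as in GEN 11/12), with concrete layers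
`A₂ = ℚ(θ) ⊔ ℚ_2` (degree `12`), `A₃ = ℚ(θ) ⊔ ℚ_3` (degree `24`).  Displayed: (hK) `h(A₂)` odd, (hL) `h(A₃)` odd, (hlow) `2^2 ≤ #(U⁺/U²)(A₂)`,
(hsig) `2^22 ≤ #sign(U_{A₃})` — all four VALUED GRH-free by eng-2 CERT-NARROW6-E2 v1.3 §6.1 (instrument tier).  BSD for `293200be1` is NOT proved by this.
[cite: EdgarMollinPeterson1986, Thm. 2.1, p. 34] [cite: Fukuda1994, Thm. 1 (2), p. 264] [cite: Washington1997, §13.1 and Lemma 13.3]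
[cite: CoatesSujatha2005, Conj. A and Thm. 3.4] -/
theorem conjA_two_293200be1_of_layerBounds₂₃
    {θ : AlgebraicClosure ℚ} (hθ : aeval θ (Cubic.toPoly ⟨1, ((-1 : ℤ) : ℚ), ((-7 : ℤ) : ℚ), ((8 : ℤ) : ℚ)⟩) = 0)
    (hK : ∀ [NumberField ↥(ℚ⟮θ⟯ ⊔ (CyclotomicZp.zpExtension 2).layer 2)],
      Odd (classNumber ↥(ℚ⟮θ⟯ ⊔ (CyclotomicZp.zpExtension 2).layer 2)))
    (hL : ∀ [NumberField ↥(ℚ⟮θ⟯ ⊔ (CyclotomicZp.zpExtension 2).layer (2 + 1))],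
      Odd (classNumber ↥(ℚ⟮θ⟯ ⊔ (CyclotomicZp.zpExtension 2).layer (2 + 1))))
    (hlow : ∀ [NumberField ↥(ℚ⟮θ⟯ ⊔ (CyclotomicZp.zpExtension 2).layer 2)],
      2 ^ 2 ≤ Nat.card (TotPosUnitsModSq ↥(ℚ⟮θ⟯ ⊔ (CyclotomicZp.zpExtension 2).layer 2)))
    (hsig : ∀ [NumberField ↥(ℚ⟮θ⟯ ⊔ (CyclotomicZp.zpExtension 2).layer (2 + 1))],
      2 ^ 22 ≤ Nat.card (Set.range (signVec (K := ↥(ℚ⟮θ⟯ ⊔ (CyclotomicZp.zpExtension 2).layer (2 + 1))))))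
    (κ : ZpExtension ℚ 2) (hκ : κ.IsCyclotomic) :
    haveI := (isElliptic_cubicModel _ _ _ (by simp only [Cubic.discr]; norm_num) : (⟨0, ((1 : ℤ) : ℚ), 0, ((-3388217033 : ℤ) : ℚ), ((-75912170159062 : ℤ) : ℚ)⟩ : WeierstrassCurve ℚ).IsElliptic)
    ∃ (γ : absoluteGaloisGroup ℚ) (D : (⟨0, ((1 : ℤ) : ℚ), 0, ((-3388217033 : ℤ) : ℚ), ((-75912170159062 : ℤ) : ℚ)⟩ : WeierstrassCurve ℚ).FineSelmerDualData κ γ),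
      Module.Finite ℤ_[2] (RestrictScalars ℤ_[2] (IwasawaAlgebra 2) D.X) := by
  haveI := (isElliptic_cubicModel _ _ _ (by simp only [Cubic.discr]; norm_num) : (⟨0, ((1 : ℤ) : ℚ), 0, ((-3388217033 : ℤ) : ℚ), ((-75912170159062 : ℤ) : ℚ)⟩ : WeierstrassCurve ℚ).IsElliptic)
  have hθ' : θ ^ 3 + (-1 : AlgebraicClosure ℚ) * θ ^ 2 + (-7 : AlgebraicClosure ℚ) * θ + (8 : AlgebraicClosure ℚ) = 0 := by
    have := hθ
    simp only [Cubic.toPoly, map_one, one_mul, aeval_add, aeval_mul, aeval_C, aeval_X_pow, aeval_X,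
      eq_ratCast, Rat.cast_intCast] at this
    push_cast at this
    linear_combination this
  obtain ⟨β, hβdef⟩ : ∃ β : AlgebraicClosure ℚ, β = algebraMap ℚ (AlgebraicClosure ℚ) (-18802 : ℚ) +
      algebraMap ℚ (AlgebraicClosure ℚ) (-18445 : ℚ) * θ + algebraMap ℚ (AlgebraicClosure ℚ) (4990 : ℚ) * θ ^ 2 := ⟨_, rfl⟩
  have hβ : aeval β (Cubic.toPoly ⟨1, ((1 : ℤ) : ℚ), ((-3388217033 : ℤ) : ℚ), ((-75912170159062 : ℤ) : ℚ)⟩) = 0 := by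
    simp only [Cubic.toPoly, map_one, one_mul, aeval_add, aeval_mul, aeval_C, aeval_X_pow, aeval_X, eq_ratCast,
      Rat.cast_intCast]
    rw [hβdef]
    simp only [eq_ratCast]
    push_cast
    linear_combination ((-2356669106875 : AlgebraicClosure ℚ) + (3304738652250 : AlgebraicClosure ℚ) * θ + (-1253595534500 : AlgebraicClosure ℚ) * θ ^ 2 + (124251499000 : AlgebraicClosure ℚ) * θ ^ 3) * hθ'
  have hadj : IntermediateField.adjoin ℚ {β} = IntermediateField.adjoin ℚ {θ} := by
    apply le_antisymm
    · rw [IntermediateField.adjoin_simple_le_iff, hβdef]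
      have hθmem := IntermediateField.mem_adjoin_simple_self ℚ θ
      exact add_mem (add_mem (algebraMap_mem _ _) (mul_mem (algebraMap_mem _ _) hθmem))
        (mul_mem (algebraMap_mem _ _) (pow_mem hθmem 2))
    · rw [IntermediateField.adjoin_simple_le_iff]
      have hθeq : θ = algebraMap ℚ (AlgebraicClosure ℚ) (-2254304911498 / 3125 : ℚ) +
          algebraMap ℚ (AlgebraicClosure ℚ) (-33538753 / 3125 : ℚ) * β +
          algebraMap ℚ (AlgebraicClosure ℚ) (998 / 3125 : ℚ) * β ^ 2 := by
        rw [hβdef]; simp only [eq_ratCast]; push_cast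
        linear_combination (((1270901104 : AlgebraicClosure ℚ) / 25) + ((-994011992 : AlgebraicClosure ℚ) / 125) * θ) * hθ'
      rw [hθeq]
      have hβmem := IntermediateField.mem_adjoin_simple_self ℚ β
      exact add_mem (add_mem (algebraMap_mem _ _) (mul_mem (algebraMap_mem _ _) hβmem))
        (mul_mem (algebraMap_mem _ _) (pow_mem hβmem 2))
  haveI : FiniteDimensional ℚ (IntermediateField.adjoin ℚ {θ}) :=
    IntermediateField.adjoin.finiteDimensional ((AlgebraicClosure.isAlgebraic ℚ).isAlgebraic θ).isIntegral
  haveI : NumberField (IntermediateField.adjoin ℚ {θ}) := NumberField.mk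
  have h3 := finrank_adjoin_eq_three_of_irreducible irreducible_cubic_disc_733 hθ
  have h3β : Module.finrank ℚ (IntermediateField.adjoin ℚ {β}) = 3 := by rw [hadj]; exact h3
  exact conjA_two_cubicModel_of_narrowRank_layer_bounds (1) (-3388217033) (-75912170159062)
    (irreducibleCubic_of_finrank_three_lb293200be1 hβ h3β) hβ irreducible_cubic_disc_733 hθ hadj (isTotallyReal_adjoin_disc733_lb hθ)
    2 (by norm_num) (a := 2) (b := 22) (by norm_num) hK hL hlow hsig κ hκ

end Summit.BirchSwinnertonDyer.BirchSwinnertonDyer.Theorems.AddKatoTwo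

/-! ## §2 The C3″ rungs (namespace `AddPotGoodInstances`) -/

namespace Summit.BirchSwinnertonDyer.BirchSwinnertonDyer.Theorems.AddPotGoodInstances

open WeierstrassCurve Polynomial NumberField Literature.NumberTheory.EllipticCurves
  Literature.NumberTheory.IwasawaTheory
  Literature.NumberTheory.NumberFields
  Literature.Geometry.Kaehler.ComplexTorus
  Literature.NumberTheory.EllipticCurves.Rank1Residual
  Literature.NumberTheory.EllipticCurves.Rank1Residual.Typed
  Summit.BirchSwinnertonDyer.Rank1Residual
  Summit.BirchSwinnertonDyer.Rank1Residual.Additive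
  Summit.BirchSwinnertonDyer.BirchSwinnertonDyer.Theorems

/-- Model transport for (A) at `2` in the `∃ γ D` spelling (the statement only depends on the Weierstrass CURVE).
[cite: CoatesSujatha2005, statement (A)] -/
private theorem conjA_two_of_eq_lb293200be1 {W W' : WeierstrassCurve ℚ} (h : W' = W)
    (H : ∀ (κ : ZpExtension ℚ 2), κ.IsCyclotomic →
      ∃ (γ : Field.absoluteGaloisGroup ℚ) (D : W'.FineSelmerDualData κ γ), Module.Finite ℤ_[2] (RestrictScalars ℤ_[2] (IwasawaAlgebra 2) D.X)) :
    ∀ (κ : ZpExtension ℚ 2), κ.IsCyclotomic →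
      ∃ (γ : Field.absoluteGaloisGroup ℚ) (D : W.FineSelmerDualData κ γ), Module.Finite ℤ_[2] (RestrictScalars ℤ_[2] (IwasawaAlgebra 2) D.X) := by
  subst h; exact H

/-! ## Row `293200be1` (Δ_cubic > 0; stamp `AddKatoTwo.conjA_two_293200be1_of_layerBounds₂₃` of §1) -/

/-- **(A) at `(293200be1, 2)` for the Cremona model from the FOUR layer-`(2,3)` data, NO print fact**: §1's stamp transported from its cast model to the literal
model. [cite: CoatesSujatha2005, statement (A)] [cite: EdgarMollinPeterson1986, Thm. 2.1] -/
theorem conjA_two_293200be1_of_layerBounds₂₃_kernelLit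
    {θ : AlgebraicClosure ℚ} (hθ : aeval θ (Cubic.toPoly ⟨1, ((-1 : ℤ) : ℚ), ((-7 : ℤ) : ℚ), ((8 : ℤ) : ℚ)⟩) = 0)
    (hK : ∀ [NumberField ↥(ℚ⟮θ⟯ ⊔ (CyclotomicZp.zpExtension 2).layer 2)],
      Odd (classNumber ↥(ℚ⟮θ⟯ ⊔ (CyclotomicZp.zpExtension 2).layer 2)))
    (hL : ∀ [NumberField ↥(ℚ⟮θ⟯ ⊔ (CyclotomicZp.zpExtension 2).layer (2 + 1))],
      Odd (classNumber ↥(ℚ⟮θ⟯ ⊔ (CyclotomicZp.zpExtension 2).layer (2 + 1))))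
    (hlow : ∀ [NumberField ↥(ℚ⟮θ⟯ ⊔ (CyclotomicZp.zpExtension 2).layer 2)],
      2 ^ 2 ≤ Nat.card (TotPosUnitsModSq ↥(ℚ⟮θ⟯ ⊔ (CyclotomicZp.zpExtension 2).layer 2)))
    (hsig : ∀ [NumberField ↥(ℚ⟮θ⟯ ⊔ (CyclotomicZp.zpExtension 2).layer (2 + 1))],
      2 ^ 22 ≤ Nat.card (Set.range (signVec (K := ↥(ℚ⟮θ⟯ ⊔ (CyclotomicZp.zpExtension 2).layer (2 + 1))))))
    :
    haveI := isElliptic_293200be1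
    ∀ (κ : ZpExtension ℚ 2), κ.IsCyclotomic →
      ∃ (γ : Field.absoluteGaloisGroup ℚ) (D : (⟨0, 1, 0, -3388217033, -75912170159062⟩ : WeierstrassCurve ℚ).FineSelmerDualData κ γ),
        Module.Finite ℤ_[2] (RestrictScalars ℤ_[2] (IwasawaAlgebra 2) D.X) :=
  conjA_two_of_eq_lb293200be1 (W' := (⟨0, ((1 : ℤ) : ℚ), 0, ((-3388217033 : ℤ) : ℚ), ((-75912170159062 : ℤ) : ℚ)⟩ : WeierstrassCurve ℚ)) (by norm_num)
    (fun κ hκ ↦ AddKatoTwo.conjA_two_293200be1_of_layerBounds₂₃ hθ hK hL hlow hsig κ hκ)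

/-- **`BSD₂(293200be1)` with (A) from the FOUR layer-`(2,3)` data and NO print fact for (A)**: GEN 3's rung `bsdp_two_293200be1_of_conjA` with `hA` from
`conjA_two_293200be1_of_layerBounds₂₃_kernelLit hθ hK hL hlow hsig`.  Conditional on PRINT {`hSharp` (reading), `hGZK`, `hmod`, `hCT`}, the RECORD `hr`, `#Ш_an = q`
(bounded `ord₂ q`), the two VALUED slots and the four VALUED (GRH-free, eng-2 v1.3) layer data.  Compared with GEN 12's `bsdp_two_293200be1_narrowRankEq_succ` the opaque
narrow-rank equality `hnr` is replaced by four elementary statements.  Nothing booked; BSD is not proved by this.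
[cite: Kato2004Asterisque, Thm. 12.5 (1)(3), 13.8, 14.14] [cite: EdgarMollinPeterson1986, Thm. 2.1] [cite: Miller2011LMS, Def. 1.1] -/
theorem bsdp_two_293200be1_layerBounds₂₃
    (hSharp : Kato2004.rankZero_padicValNat_sha_add_padicValNat_tamagawa_le_at_two_of_irreducible_of_fineSelmerDual_fg)
    (hGZK : rank_eq_analyticRank_of_analyticRank_le_one) (hmod : hasEntireLFunction_rat)
    (hCT : exists_casselsTate_pairing (K := ℚ))
    {θ : AlgebraicClosure ℚ} (hθ : aeval θ (Cubic.toPoly ⟨1, ((-1 : ℤ) : ℚ), ((-7 : ℤ) : ℚ), ((8 : ℤ) : ℚ)⟩) = 0)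
    (hK : ∀ [NumberField ↥(ℚ⟮θ⟯ ⊔ (CyclotomicZp.zpExtension 2).layer 2)],
      Odd (classNumber ↥(ℚ⟮θ⟯ ⊔ (CyclotomicZp.zpExtension 2).layer 2)))
    (hL : ∀ [NumberField ↥(ℚ⟮θ⟯ ⊔ (CyclotomicZp.zpExtension 2).layer (2 + 1))],
      Odd (classNumber ↥(ℚ⟮θ⟯ ⊔ (CyclotomicZp.zpExtension 2).layer (2 + 1))))
    (hlow : ∀ [NumberField ↥(ℚ⟮θ⟯ ⊔ (CyclotomicZp.zpExtension 2).layer 2)],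
      2 ^ 2 ≤ Nat.card (TotPosUnitsModSq ↥(ℚ⟮θ⟯ ⊔ (CyclotomicZp.zpExtension 2).layer 2)))
    (hsig : ∀ [NumberField ↥(ℚ⟮θ⟯ ⊔ (CyclotomicZp.zpExtension 2).layer (2 + 1))],
      2 ^ 22 ≤ Nat.card (Set.range (signVec (K := ↥(ℚ⟮θ⟯ ⊔ (CyclotomicZp.zpExtension 2).layer (2 + 1))))))
    (hr : haveI := isElliptic_293200be1; (⟨0, 1, 0, -3388217033, -75912170159062⟩ : WeierstrassCurve ℚ).analyticRank = 0)
    (hs₁ : Nat.card ((⟨0, 1, 0, -3388217033, -75912170159062⟩ : WeierstrassCurve ℚ).selmerGroup (2 ^ 2)) = 2 ^ 4)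
    (hs₂ : Nat.card ((⟨0, 1, 0, -3388217033, -75912170159062⟩ : WeierstrassCurve ℚ).selmerGroup (2 ^ (2 + 1))) = 2 ^ 6)
    {q : ℚ} (hq : haveI := isElliptic_293200be1; shaAn (⟨0, 1, 0, -3388217033, -75912170159062⟩ : WeierstrassCurve ℚ) = (q : ℂ)) (hv : padicValRat 2 q ≤ 6) :
    haveI := isElliptic_293200be1; haveI := isGloballyMinimal_293200be1
    BSDp (⟨0, 1, 0, -3388217033, -75912170159062⟩ : WeierstrassCurve ℚ) 2 := by
  exact bsdp_two_293200be1_of_conjA hSharp hGZK hmod hCT (conjA_two_293200be1_of_layerBounds₂₃_kernelLit hθ hK hL hlow hsig) hr hs₁ hs₂ hq hv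

/-- **`BSD₂` ON THE WHOLE CLASS of `293200be1` with (A) from the FOUR layer-`(2,3)` data and NO print fact for (A)**: GEN 3's class rung (Cassels transport
`hCassels`) with `hA` from `conjA_two_293200be1_of_layerBounds₂₃_kernelLit hθ hK hL hlow hsig`.  Nothing booked; BSD is not proved by this.
[cite: Cassels1965ArithmeticVIII, Thm. 1.3] [cite: Kato2004Asterisque, Thm. 12.5 (1)(3)] [cite: EdgarMollinPeterson1986, Thm. 2.1] -/
theorem bsdp_two_of_isIsogenous_293200be1_layerBounds₂₃
    (hSharp : Kato2004.rankZero_padicValNat_sha_add_padicValNat_tamagawa_le_at_two_of_irreducible_of_fineSelmerDual_fg)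
    (hGZK : rank_eq_analyticRank_of_analyticRank_le_one) (hmod : hasEntireLFunction_rat)
    (hCT : exists_casselsTate_pairing (K := ℚ)) (hCassels : bsdRHS_eq_of_isIsogenous)
    {θ : AlgebraicClosure ℚ} (hθ : aeval θ (Cubic.toPoly ⟨1, ((-1 : ℤ) : ℚ), ((-7 : ℤ) : ℚ), ((8 : ℤ) : ℚ)⟩) = 0)
    (hK : ∀ [NumberField ↥(ℚ⟮θ⟯ ⊔ (CyclotomicZp.zpExtension 2).layer 2)],
      Odd (classNumber ↥(ℚ⟮θ⟯ ⊔ (CyclotomicZp.zpExtension 2).layer 2)))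
    (hL : ∀ [NumberField ↥(ℚ⟮θ⟯ ⊔ (CyclotomicZp.zpExtension 2).layer (2 + 1))],
      Odd (classNumber ↥(ℚ⟮θ⟯ ⊔ (CyclotomicZp.zpExtension 2).layer (2 + 1))))
    (hlow : ∀ [NumberField ↥(ℚ⟮θ⟯ ⊔ (CyclotomicZp.zpExtension 2).layer 2)],
      2 ^ 2 ≤ Nat.card (TotPosUnitsModSq ↥(ℚ⟮θ⟯ ⊔ (CyclotomicZp.zpExtension 2).layer 2)))
    (hsig : ∀ [NumberField ↥(ℚ⟮θ⟯ ⊔ (CyclotomicZp.zpExtension 2).layer (2 + 1))],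
      2 ^ 22 ≤ Nat.card (Set.range (signVec (K := ↥(ℚ⟮θ⟯ ⊔ (CyclotomicZp.zpExtension 2).layer (2 + 1))))))
    {W : WeierstrassCurve ℚ} [W.IsElliptic] [W.IsGloballyMinimal]
    (hiso : haveI := isElliptic_293200be1; IsIsogenous W (⟨0, 1, 0, -3388217033, -75912170159062⟩ : WeierstrassCurve ℚ)) (hr : W.analyticRank = 0)
    (hs₁ : Nat.card ((⟨0, 1, 0, -3388217033, -75912170159062⟩ : WeierstrassCurve ℚ).selmerGroup (2 ^ 2)) = 2 ^ 4)
    (hs₂ : Nat.card ((⟨0, 1, 0, -3388217033, -75912170159062⟩ : WeierstrassCurve ℚ).selmerGroup (2 ^ (2 + 1))) = 2 ^ 6)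
    {q : ℚ} (hq : haveI := isElliptic_293200be1; shaAn (⟨0, 1, 0, -3388217033, -75912170159062⟩ : WeierstrassCurve ℚ) = (q : ℂ)) (hv : padicValRat 2 q ≤ 6) :
    BSDp W 2 := by
  exact bsdp_two_of_isIsogenous_293200be1_of_conjA hSharp hGZK hmod hCT hCassels (conjA_two_293200be1_of_layerBounds₂₃_kernelLit hθ hK hL hlow hsig) hiso hr hs₁ hs₂ hq hv

end Summit.BirchSwinnertonDyer.BirchSwinnertonDyer.Theorems.AddPotGoodInstances

end
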